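import Literature.NumberTheory.EllipticCurves.KummerImageIsotropy
import Literature.NumberTheory.GaloisCohomology.PoitouTate
import HarnessLib

/-!
# The Weil pairing as a duality `E[n] → E[n]^D = Hom(E[n], μₙ)`, and the Poitou–Tate local terms of `E[n]`

Topic `NumberTheory/EllipticCurves`; namespace `Literature.NumberTheory.EllipticCurves` (as the sibling
`KummerImageIsotropy.lean`, whose packaging `weilPairingHom` / `weilContPairing` of a Weil pairing is
reused). Definitions with bodies and theorems only: **no named fact is introduced** (D-0026).

The arithmetic duality statements of the tree for a finite discrete `Γ_K`-module `M` killed by `n` —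
local Tate duality and the Poitou–Tate vanishing `∑_v inv_v(loc_v x ∪ loc_v y) = 0`
(`Literature.NumberTheory.GaloisCohomology.LocalInvariants.localTerm`, `.SumLocalTermEqZero`, the named
fact `poitouTate_sum_localTatePairing_eq_zero`) — pair `H¹(K, M)` with `H¹(K, M^D)`, `M^D = Hom(M, μₙ)`
the Tate dual (`DiscreteGaloisModule.tateDual`), through the EVALUATION pairing `M × M^D → μₙ`
(`tateDualPairing`). In the construction of the Cassels–Tate pairing (Milne, *ADT*, I, proof of
Prop. 6.9) the module is `M = E[m]` and the pairing is "the cup-product induced by the `e_m`-pairing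
`A_m × A^t_m → 𝔾_m`", i.e. for an elliptic curve the Weil pairing `e : E[m] × E[m] → μ_m` identifying
`E[m]` with its own Tate dual. This file supplies that identification and transports the local terms:

* `weilDualHom W n e …  : E[n] →+ E[n]^D`, `T ↦ (S ↦ e(S, T))`, `Γ`-equivariant for the Tate-dual
  action (`weilDualHom_smul`, from `e(σS, σT) = σ e(S, T)`), packaged as a morphism of discrete Galois
  modules `weilDualIntertwining : E[n] →ⁱ E[n]^D`; injective for `e` non-degenerate
  (`weilDualHom_injective`);
* **`x ∪ₑ y = x ∪_{ev} w_* y`** in `H²(F, μₙ)` for `x, y ∈ H¹(F, E[n])` (`cupProduct_weilContPairing_eq`,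
  adjoint naturality of the cup product, tree `ContPairing.cupProduct_adjoint`) — over any field `F`;
* over a number field `K`: the local Weil pairings `weilContPairingLocal W n e … v` of the restricted
  modules at a place `v`, `loc_v (x ∪ₑ y) = loc_v x ∪_{e,v} loc_v y` (`localization_weilCupProduct`),
  and **the Poitou–Tate local term of the pair `(x, w_* y)` is `inv_v (loc_v x ∪_{e,v} loc_v y)`**
  (`localTerm_weilDual`, `localTerm_weilDual_eq_inv_cupProduct_localization`); consequently the
  Poitou–Tate vanishing of a family `inv` gives `∑_{v ∈ S} inv_v (loc_v x ∪_{e,v} loc_v y) = 0`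
  (`sum_inv_weilCupProduct_localization_eq_zero`) — the reciprocity that makes Milne's pairing
  independent of the choice of the global lift `b₁` (the difference is such a sum for a global
  `c ∈ H¹(K, E[m])`).

As in `KummerImageIsotropy.lean`, everything is stated for an arbitrary biadditive `Γ`-equivariant
`μₙ`-valued `e` on `E[n]` (the tree's Weil pairing `WeierstrassCurve.exists_weilPairing` being
existential). Motivation: provefact `WeierstrassCurve.exists_casselsTate_pairing` (Silverman *AEC*
X.4.14; Milne *ADT* I.6.9/6.13).

## References

* [MilneADT2006] J. S. Milne, *Arithmetic Duality Theorems*, 2nd ed. (2006), Ch. I: §2 (`M^D`,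
  Cor. 2.3), Thm. 4.10(b), §6, proof of Prop. 6.9 (pp. 78–79).
* [SilvermanAEC2009] J. H. Silverman, *The Arithmetic of Elliptic Curves*, 2nd ed. (2009), III.§8
  (the Weil pairing, Prop. III.8.1), Cor. III.6.4.
* [NeukirchSchmidtWingberg2008] J. Neukirch, A. Schmidt, K. Wingberg, *Cohomology of Number Fields*
  (2008), I §4 (1.4.2) (naturality of cup products).
-/

noncomputable section

open scoped Classical

universe u

namespace Literature.NumberTheory.EllipticCurves

open CategoryTheory WeierstrassCurve Field
open Literature.NumberTheory.GaloisRepresentations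
open Literature.NumberTheory.GaloisRepresentations.DiscreteGaloisModule (mu MuCarrier pairing TateDual
  tateDual tateDualPairing tateDualEval)
open scoped ContRepresentation

-- Cup products need `LocallyCompactSpace Γ_F`; as in `LocalTatePairing.lean` / `KummerImageIsotropy.lean`,
-- the compactness of absolute Galois groups is a local instance only.
attribute [local instance] absoluteGaloisGroup_compactSpace

variable {F : Type u} [Field F] (W : WeierstrassCurve F) (n : ℕ) [NeZero n]

/-- `E[n]` is finite for an elliptic curve and `n ≠ 0` (Silverman, *AEC*, Cor. III.6.4; the tree's
`finite_torsionPoints_holds`), in the form needed to speak of the Tate dual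
`DiscreteGaloisModule.tateDual` of `W.torsionGaloisModule n`. A local instance in this file.
[cite: SilvermanAEC2009, Cor. III.6.4] -/
theorem finite_geomTorsion_of_neZero [W.IsElliptic] : Finite (geomTorsion W n) :=
  finite_torsionPoints_holds W (AlgebraicClosure F) (by exact_mod_cast NeZero.ne n)

attribute [local instance] finite_geomTorsion_of_neZero

variable [W.IsElliptic]
variable (e : geomTorsion W n → geomTorsion W n → AlgebraicClosure F)
  (hμ : ∀ S T, e S T ^ n = 1)
  (hadd₁ : ∀ S₁ S₂ T, e (S₁ + S₂) T = e S₁ T * e S₂ T)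
  (hadd₂ : ∀ S T₁ T₂, e S (T₁ + T₂) = e S T₁ * e S T₂)

/-! ### The Weil dual map `T ↦ e(·, T)` -/

/-- **The Weil dual map** `E[n] → E[n]^D = Hom(E[n], μₙ)`, `T ↦ (S ↦ e(S, T))`, for a biadditive
`μₙ`-valued pairing `e` on `E[n]` (a Weil pairing in the sense of `WeierstrassCurve.exists_weilPairing`).
Milne, *ADT*, I §6 ("the `e_m`-pairing `A_m × A^t_m → 𝔾_m`" identifying `A^t_m` with `(A_m)^D`);
Silverman, *AEC*, III.§8. [folklore] -/
def weilDualHom : geomTorsion W n →+ TateDual F (geomTorsion W n) n :=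
  AddMonoidHom.mk' (fun T => (weilPairingHom W n e hμ hadd₁ hadd₂).flip T) fun T T' => by
    exact map_add (weilPairingHom W n e hμ hadd₁ hadd₂).flip T T'

omit [W.IsElliptic] in
/-- Unfolding `weilDualHom`: `(weilDualHom T) S = e(S, T)` (as an element of `μₙ`). [folklore] -/
@[simp]
theorem weilDualHom_apply_apply (S T : geomTorsion W n) :
    weilDualHom W n e hμ hadd₁ hadd₂ T S = weilPairingHom W n e hμ hadd₁ hadd₂ S T :=
  rfl

/-- **The Weil dual map is `Γ_F`-equivariant** for the Tate-dual action
`(σ f)(S) = σ f(σ⁻¹ S)` on `Hom(E[n], μₙ)`: `e(·, σT) = σ ∘ e(σ⁻¹ ·, T)` by the Galois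
equivariance of `e` (Silverman, *AEC*, III.8.1 (d)). [folklore] -/
theorem weilDualHom_smul
    (hgal : ∀ (σ : absoluteGaloisGroup F) (S T : geomTorsion W n), σ • e S T = e (σ • S) (σ • T))
    (σ : absoluteGaloisGroup F) (T : geomTorsion W n) :
    weilDualHom W n e hμ hadd₁ hadd₂ (σ • T) =
      (W.torsionGaloisModule n).tateDual n σ (weilDualHom W n e hμ hadd₁ hadd₂ T) := by
  refine TateDual.ext fun S => ?_
  rw [DiscreteGaloisModule.tateDual_apply_apply_apply, weilDualHom_apply_apply,
    weilDualHom_apply_apply, torsionGaloisModule_apply_apply]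
  apply MuCarrier.toAdditive.injective
  rw [DiscreteGaloisModule.mu_apply_apply]
  apply Additive.toMul.injective
  apply Subtype.ext
  apply Units.ext
  rw [toMul_ofMul, absoluteGaloisGroup.coe_smul_rootsOfUnity, Units.coe_smul]
  change e S (σ • T) = σ • e (σ⁻¹ • S) T
  rw [hgal, smul_inv_smul]

variable (hgal : ∀ (σ : absoluteGaloisGroup F) (S T : geomTorsion W n), σ • e S T = e (σ • S) (σ • T))

/-- **The Weil dual map as a morphism of discrete Galois modules** `E[n] → E[n]^D`
(continuous `Γ_F`-intertwining map; input of `galoisCohomology.map`). [folklore] -/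
def weilDualIntertwining :
    (W.torsionGaloisModule n).toContRepresentation →ⁱL
      ((W.torsionGaloisModule n).tateDual n).toContRepresentation where
  toContinuousLinearMap :=
    ⟨(weilDualHom W n e hμ hadd₁ hadd₂).toIntLinearMap, continuous_of_discreteTopology⟩
  isIntertwining' σ := by
    refine ContinuousLinearMap.ext fun T => ?_
    exact weilDualHom_smul W n e hμ hadd₁ hadd₂ hgal σ T

/-- Unfolding `weilDualIntertwining`. [folklore] -/
@[simp]
theorem weilDualIntertwining_apply (T : geomTorsion W n) :
    weilDualIntertwining W n e hμ hadd₁ hadd₂ hgal T = weilDualHom W n e hμ hadd₁ hadd₂ T :=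
  rfl

omit [W.IsElliptic] in
/-- The Weil dual map is injective when `e` is non-degenerate on the right
(`e(S, T) = 1` for all `S` forces `T = 0`; Silverman, *AEC*, III.8.1 (c)). [folklore] -/
theorem weilDualHom_injective (hnondeg : ∀ T, (∀ S, e S T = 1) → T = 0) :
    Function.Injective (weilDualHom W n e hμ hadd₁ hadd₂) := by
  refine (injective_iff_map_eq_zero _).mpr fun T hT => hnondeg T fun S => ?_
  have h : weilPairingHom W n e hμ hadd₁ hadd₂ S T = 0 :=
    congrArg (fun f : TateDual F (geomTorsion W n) n => f S) hT
  rw [muCarrier_eq_iff, coe_weilPairingHom] at h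
  exact h

/-! ### Cup products: `x ∪ₑ y = x ∪_{ev} w_* y` -/

/-- **The Weil-pairing cup product is the evaluation cup product after the Weil dual map**:
for `x, y ∈ H¹(F, E[n])`,

  `x ∪ₑ y = x ∪_{ev} H¹(w)(y)`  in `H²(F, μₙ)`,

where `∪ₑ` is the cup product of the pairing `e : E[n] × E[n] → μₙ` (`weilContPairing`), `∪_{ev}`
that of the evaluation `E[n] × E[n]^D → μₙ` (`tateDualPairing`, the pairing of local Tate duality and
of the Poitou–Tate local terms) and `w : E[n] → E[n]^D` the Weil dual map (adjoint naturality of the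
cup product, `ContPairing.cupProduct_adjoint`, with `e(S, T) = (w T)(S)`). Milne, *ADT*, I §6, proof
of Prop. 6.9 ("the cup-product is induced by the `e_m`-pairing"). [folklore] -/
theorem cupProduct_weilContPairing_eq (x y : galoisCohomology (W.torsionGaloisModule n) 1) :
    (weilContPairing W n e hμ hadd₁ hadd₂ hgal).cupProduct x y =
      (tateDualPairing (W.torsionGaloisModule n) n).cupProduct x
        (galoisCohomology.map (weilDualIntertwining W n e hμ hadd₁ hadd₂ hgal) 1 y) := by
  have h := ContPairing.cupProduct_adjoint (tateDualPairing (W.torsionGaloisModule n) n)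
    (weilContPairing W n e hμ hadd₁ hadd₂ hgal) (𝟙 _)
    (TopRep.ofHom ⟨(weilDualIntertwining W n e hμ hadd₁ hadd₂ hgal).toContinuousLinearMap,
      (weilDualIntertwining W n e hμ hadd₁ hadd₂ hgal).isIntertwining'⟩)
    (fun S T => rfl) x y
  have h1 : (cohomologyMap (𝟙 (W.torsionGaloisModule n).toTopRep) 1) x = x := by
    rw [show cohomologyMap (𝟙 (W.torsionGaloisModule n).toTopRep) 1 = 𝟙 _ from
      map_id_eq_id _ (fun _ => rfl) 1]
    rfl
  rw [h1] at h
  exact h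

/-! ### Over a number field: local Weil pairings and the Poitou–Tate local terms of `E[n]` -/

section NumberField

open NumberField
open Literature.NumberTheory.GaloisCohomology

variable {K : Type u} [Field K] [NumberField K] (W : WeierstrassCurve K) (n : ℕ) [NeZero n]
  [W.IsElliptic]
variable (e : geomTorsion W n → geomTorsion W n → AlgebraicClosure K)
  (hμ : ∀ S T, e S T ^ n = 1)
  (hadd₁ : ∀ S₁ S₂ T, e (S₁ + S₂) T = e S₁ T * e S₂ T)
  (hadd₂ : ∀ S T₁ T₂, e S (T₁ + T₂) = e S T₁ * e S T₂)
  (hgal : ∀ (σ : absoluteGaloisGroup K) (S T : geomTorsion W n), σ • e S T = e (σ • S) (σ • T))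

/-- **The local Weil pairing at a place `v`**: the pairing `e : E[n] × E[n] → μₙ` of the restricted
modules `E[n]|_{Γ_{K_v}}`, `μₙ|_{Γ_{K_v}}` (`DiscreteGaloisModule.toLocal`), whose cup product is the
local pairing `H¹(K_v, E[n]) × H¹(K_v, E[n]) → H²(K_v, μₙ)` of Milne's sum `∑_v inv_v(c_v ∪ b'_v)`
(*ADT* I, proof of Prop. 6.9) and of the local term of the isotropy statements; built like the
tree's `tateDualPairingLocal`. [cite: MilneADT2006, Ch. I §6, proof of Prop. 6.9] -/
def weilContPairingLocal (v : Place K) :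
    ContPairing ((W.torsionGaloisModule n).toLocal v).toTopRep
      ((W.torsionGaloisModule n).toLocal v).toTopRep ((mu K n).toLocal v).toTopRep :=
  pairing ((W.torsionGaloisModule n).toLocal v) ((W.torsionGaloisModule n).toLocal v)
    ((mu K n).toLocal v) (weilPairingHom W n e hμ hadd₁ hadd₂) fun σ S T =>
      (weilContPairing W n e hμ hadd₁ hadd₂ hgal).toLin_smul
        (absGaloisRestrict K (Place.Completion v) σ) S T

omit [W.IsElliptic] in
/-- Unfolding `weilContPairingLocal`: its bilinear map is `weilPairingHom`. [folklore] -/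
@[simp] theorem weilContPairingLocal_toLin_apply (v : Place K) (S T : geomTorsion W n) :
    (weilContPairingLocal W n e hμ hadd₁ hadd₂ hgal v).toLin S T =
      weilPairingHom W n e hμ hadd₁ hadd₂ S T := rfl

omit [W.IsElliptic] in
/-- **Localisation commutes with the Weil cup product**: for global `x, y ∈ H¹(K, E[n])`,
`loc_v (x ∪ₑ y) = loc_v x ∪_{e,v} loc_v y` in `H²(K_v, μₙ)` (`ContPairing.cupProduct_res` along
`Γ_{K_v} → Γ_K`; cf. the tree's `LocalInvariants.localization_cupProduct` for the evaluation pairing).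
[folklore] -/
theorem localization_weilCupProduct (v : Place K)
    (x y : galoisCohomology (W.torsionGaloisModule n) 1) :
    galoisCohomology.localization (mu K n) v 2
        ((weilContPairing W n e hμ hadd₁ hadd₂ hgal).cupProduct x y) =
      (weilContPairingLocal W n e hμ hadd₁ hadd₂ hgal v).cupProduct
        (galoisCohomology.localization (W.torsionGaloisModule n) v 1 x)
        (galoisCohomology.localization (W.torsionGaloisModule n) v 1 y) :=
  ContPairing.cupProduct_res (weilContPairing W n e hμ hadd₁ hadd₂ hgal)
    (absGaloisRestrict K (Place.Completion v)) x y

/-- **The Poitou–Tate local term of `E[n]` is `inv_v` of the local Weil cup product**: for a family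
of local invariant maps `inv` (`LocalInvariants`, file `GaloisCohomology/PoitouTate`), a place `v`
and global classes `x, y ∈ H¹(K, E[n])`,

  `⟨x_v, (w_* y)_v⟩_v = inv_v (loc_v x ∪_{ev} loc_v (w_* y)) = inv_v (loc_v (x ∪ₑ y))`,

where `w_* : H¹(K, E[n]) → H¹(K, E[n]^D)` is induced by the Weil dual map. So the local terms of
Milne's construction, `inv_v(loc_v x ∪ₑ loc_v y)`, ARE local Tate terms in the sense of the tree's
Poitou–Tate fact, for the pair `(x, w_* y)`. Milne, *ADT*, I §6, proof of Prop. 6.9, with I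
Thm. 4.10(b). [cite: MilneADT2006, Ch. I §6, proof of Prop. 6.9] -/
theorem localTerm_weilDual (inv : LocalInvariants K n) (v : Place K)
    (x y : galoisCohomology (W.torsionGaloisModule n) 1) :
    inv.localTerm (W.torsionGaloisModule n) v x
        (galoisCohomology.map (weilDualIntertwining W n e hμ hadd₁ hadd₂ hgal) 1 y) =
      inv v (galoisCohomology.localization (mu K n) v 2
        ((weilContPairing W n e hμ hadd₁ hadd₂ hgal).cupProduct x y)) := by
  rw [LocalInvariants.localTerm_eq_apply_localization_cupProduct, cupProduct_weilContPairing_eq]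

/-- The same with the localised cup product written locally:
`⟨x_v, (w_* y)_v⟩_v = inv_v (loc_v x ∪_{e,v} loc_v y)`. [folklore] -/
theorem localTerm_weilDual_eq_inv_cupProduct_localization (inv : LocalInvariants K n) (v : Place K)
    (x y : galoisCohomology (W.torsionGaloisModule n) 1) :
    inv.localTerm (W.torsionGaloisModule n) v x
        (galoisCohomology.map (weilDualIntertwining W n e hμ hadd₁ hadd₂ hgal) 1 y) =
      inv v ((weilContPairingLocal W n e hμ hadd₁ hadd₂ hgal v).cupProduct
        (galoisCohomology.localization (W.torsionGaloisModule n) v 1 x)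
        (galoisCohomology.localization (W.torsionGaloisModule n) v 1 y)) := by
  rw [localTerm_weilDual, localization_weilCupProduct]

/-- **Poitou–Tate for the Weil cup product on `E[n]`.** If the family `inv` satisfies the
Poitou–Tate vanishing (`LocalInvariants.SumLocalTermEqZero`, the content of the tree's named fact
`poitouTate_sum_localTatePairing_eq_zero`), then for global classes `x, y ∈ H¹(K, E[n])` and every
finite set of places `S` outside which the terms vanish,

  `∑_{v ∈ S} inv_v (loc_v x ∪_{e,v} loc_v y) = 0`

— the reciprocity used for the independence of Milne's pairing from the choice of the global lift
`b₁` (*ADT* I, proof of Prop. 6.9: the difference of two definitions is `∑_v inv_v(c_v ∪ b'_v)` for a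
GLOBAL `c ∈ H¹(K, A_m)`, which vanishes by Thm. 4.10(b)). [cite: MilneADT2006, Ch. I, Thm. 4.10(b) and proof of Prop. 6.9] -/
theorem sum_inv_weilCupProduct_localization_eq_zero (inv : LocalInvariants K n)
    (hPT : inv.SumLocalTermEqZero) (x y : galoisCohomology (W.torsionGaloisModule n) 1)
    (S : Finset (Place K))
    (hS : ∀ v ∉ S, inv v ((weilContPairingLocal W n e hμ hadd₁ hadd₂ hgal v).cupProduct
      (galoisCohomology.localization (W.torsionGaloisModule n) v 1 x)
      (galoisCohomology.localization (W.torsionGaloisModule n) v 1 y)) = 0) :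
    ∑ v ∈ S, inv v ((weilContPairingLocal W n e hμ hadd₁ hadd₂ hgal v).cupProduct
      (galoisCohomology.localization (W.torsionGaloisModule n) v 1 x)
      (galoisCohomology.localization (W.torsionGaloisModule n) v 1 y)) = 0 := by
  have h := hPT (W.torsionGaloisModule n) (fun m => AddSubgroup.torsionBy.nsmul m) x
    (galoisCohomology.map (weilDualIntertwining W n e hμ hadd₁ hadd₂ hgal) 1 y) S
    (fun v hv => by
      rw [localTerm_weilDual_eq_inv_cupProduct_localization]
      exact hS v hv)
  simpa only [localTerm_weilDual_eq_inv_cupProduct_localization] using h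

end NumberField

end Literature.NumberTheory.EllipticCurves
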